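import Mathlib
import Summits.MatrixMultiplication.Statement
import Summits.MatrixMultiplication.MatrixMultiplication.Theorems.GraphEquationsDegreeOrderBridge
import Summits.MatrixMultiplication.MatrixMultiplication.Theorems.GraphEquationsDerivations
import Summits.MatrixMultiplication.MatrixMultiplication.Theorems.GraphEquationsCubicDictionaryConverse

/-!
# Degree four masks EVERY isolation order: chain systems and masking certificates (`GraphEquations`, kernel M71)

Decomp-mm node «GraphEquations» (lens 5, «finite/base range + asymptotic regime + bridge»);
attacked leaf `MultiplicityReduction` (stmt-MatrixMultiplication-27806); target of the node,
VERBATIM: `_root_.MatrixMultiplication`.  Kernel M70 (`GraphEquationsDegreeOrderBridge`) typed the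
candidate bridge of the degree ladder, `DegreeBoundsIsoOrder D K` («every correct system with tests
of degree `≤ D` has its test IDEAL initially isolated to order `K` over SOME base pair») and proved
`DegreeBoundsIsoOrder D 2 → EquationsForceMultiplicationDeg D`.  This file DECIDES that hypothesis
for every `D ≥ 4` and every `K`: **it is false** (`not_degreeBoundsIsoOrder_of_four_le`).  The
in-ideal isolation ORDER is not a currency in which any rung `D ≥ 4` of the degree ladder can be
paid (the cubic rungs `D ≤ 3` are `equationsForceMultiplicationDeg_of_le_three`, M67).

**Witnesses: CHAIN SYSTEMS** (`chainTest`).  Enumerate the `m = n²` positions `p₀, …, p_{m−1}` and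
test `t_i = f_{p_i} − f_{p_{i+1}}² (i + 1 < m)`, `t_{m−1} = f_{p₀}²`: degree `≤ 4`
(`totalDegree_chainTest_le`), common zeros exactly the graph (`chainTest_zero_iff`, induction along
the chain), so a realisation (`exists_gates_exposing`, M44) is a CORRECT degree-`4` system; in the
fibre coordinates `F = C − AB` its test ideal `(F_{p_i} − F_{p_{i+1}}², F_{p₀}²)` has CONSTANT
coefficients and curvilinear fibre algebra `ℂ[s]/(s^{2^m})` (`F_{p_i} ↦ s^{2^{m−1−i}}`): masked to
order `2^m − 1` over EVERY base pair (`exists_chainSystem`).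

**Tool: MASKING CERTIFICATES** (`maskHom`, `not_idealInitIsolatedAt_of_maskCert`).  A weighted
substitution `ψ : ℂ[A,B][F] → ℂ[A,B][s]`, `F_v ↦ λ_v s^{w_v}` (`w_v ≥ 1`) with `s^N ∣ ψ(liftF t)` for
every test `t`.  For any member `u` of the test ideal, `G = liftF u` is the unique `G` with
`G(a,b;f) = u`; if its components below `ν < N` vanish, the degree-`ν` component evaluated at
`Λ = (λ_v if w_v = 1, else 0)` is the coefficient of `s^ν` in `ψ(G)`
(`eval_maskVec_homogeneousComponent`: degree `≤` weighted degree, with equality iff the monomial has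
degree `ν` on weight-one variables), hence `0`.  So every specialised initial form of order `≤ K < N`
of every ideal member vanishes at `Λ(y) ≠ 0`, refuting `IdealInitIsolatedAt K y` — no Gröbner
basis, no colength, no cost bookkeeping.

Results (no `sorry`): `not_idealInitIsolatedAt_of_maskCert`; `exists_chainSystem :
1 ≤ n → ∃ E, E.Correct ∧ E.IsDegLe 4 ∧ ∀ K < 2^(n·n), ∀ y, ¬ E.IdealInitIsolatedAt K y`;
`not_degreeBoundsIsoOrder_four`, `not_degreeBoundsIsoOrder_of_four_le`,
`exists_correct_degFour_not_idealIso_two` (the `K = 2` instance M70 asked for, every `n ≥ 2`),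
`degreeLadder_orderDial_summary` (the cubic side `DegreeBoundsIsoOrder 3 K` is not treated).  Sources: [BurgisserClausenShokrollahi1997, Problem 16.3, (4.2)]; Leykin–Verschelde–Zhao, TCS 359
(2006) [doi:10.1016/j.tcs.2006.02.018] (deflation of curvilinear singularities; context only).
-/

set_option linter.dupNamespace false

noncomputable section

open scoped BigOperators Polynomial

namespace Summit.MatrixMultiplication.MatrixMultiplication.Theorems.GraphEquations

open MvPolynomial
open Literature.Computability.AlgebraicComplexity
open Literature.Computability.AlgebraicComplexity.ArithCircuit

variable {n : ℕ}

/-! ## Masking certificates -/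

section MaskCert

variable (lam : Fin n × Fin n → MvPolynomial (MatMulVars n) ℂ) (w : Fin n × Fin n → ℕ)

/-- The weighted substitution `ψ : F_v ↦ λ_v · s^{w_v}` on `ℂ[A,B][F]`, values in `ℂ[A,B][s]`. -/
def maskHom : FPoly n →ₐ[MvPolynomial (MatMulVars n) ℂ] Polynomial (MvPolynomial (MatMulVars n) ℂ) :=
  aeval fun v => Polynomial.C (lam v) * Polynomial.X ^ (w v)

/-- The MASKED VECTOR `Λ_v = λ_v` on the weight-one variables, `0` elsewhere. -/
def maskVec : Fin n × Fin n → MvPolynomial (MatMulVars n) ℂ := fun v => if w v = 1 then lam v else 0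

/-- `ψ` on a monomial: `g · F^d ↦ (g · λ^d) · s^{Σ w_v d_v}`. -/
theorem maskHom_monomial (d : Fin n × Fin n →₀ ℕ) (g : MvPolynomial (MatMulVars n) ℂ) :
    maskHom lam w (monomial d g) =
      Polynomial.C (g * ∏ v, lam v ^ d v) * Polynomial.X ^ (∑ v, w v * d v) := by
  rw [maskHom, aeval_monomial, Finsupp.prod_fintype _ _ (fun v => by simp)]
  simp only [mul_pow, ← pow_mul, Finset.prod_mul_distrib, Finset.prod_pow_eq_pow_sum, map_mul,
    map_prod, map_pow, Polynomial.algebraMap_eq]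
  ring

/-- The coefficient of `s^j` in `ψ(G)`. -/
theorem coeff_maskHom (G : FPoly n) (j : ℕ) :
    (maskHom lam w G).coeff j =
      ∑ d ∈ G.support, if ∑ v, w v * d v = j then coeff d G * ∏ v, lam v ^ d v else 0 := by
  conv_lhs => rw [G.as_sum, map_sum, Polynomial.finsetSum_coeff]
  refine Finset.sum_congr rfl fun d _ => ?_
  rw [maskHom_monomial, Polynomial.coeff_C_mul_X_pow]
  split_ifs with h1 h2 h2 <;> first | rfl | exact absurd h1.symm h2 | exact absurd h2.symm h1

variable {lam w}

/-- Degree `≤` weighted degree when all weights are `≥ 1`. -/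
theorem degree_le_wdeg (hw : ∀ v, 1 ≤ w v) (d : Fin n × Fin n →₀ ℕ) : d.degree ≤ ∑ v, w v * d v := by
  rw [Finsupp.degree_eq_sum]
  exact Finset.sum_le_sum fun v _ => by nlinarith [hw v]

/-- Equality in `degree_le_wdeg` forces every variable in the support to have weight one. -/
theorem wdeg_eq_degree_iff (hw : ∀ v, 1 ≤ w v) (d : Fin n × Fin n →₀ ℕ) :
    ∑ v, w v * d v = d.degree ↔ ∀ v, d v ≠ 0 → w v = 1 := by
  rw [Finsupp.degree_eq_sum]
  constructor
  · intro h v hv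
    by_contra hne
    have hlt : d v < w v * d v := by
      have : 2 ≤ w v := by have := hw v; omega
      nlinarith [Nat.pos_of_ne_zero hv]
    have : ∑ u, d u < ∑ u, w u * d u :=
      Finset.sum_lt_sum (fun u _ => by nlinarith [hw u]) ⟨v, Finset.mem_univ _, hlt⟩
    omega
  · intro h
    refine Finset.sum_congr rfl fun v _ => ?_
    by_cases hv : d v = 0
    · simp [hv]
    · rw [h v hv, one_mul]

/-- `λ^d = Λ^d` on monomials living on the weight-one variables, and `Λ^d = 0` otherwise. -/
theorem prod_maskVec_pow (d : Fin n × Fin n →₀ ℕ) :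
    ∏ v, maskVec lam w v ^ d v = if ∀ v, d v ≠ 0 → w v = 1 then ∏ v, lam v ^ d v else 0 := by
  split_ifs with h
  · refine Finset.prod_congr rfl fun v _ => ?_
    by_cases hv : d v = 0
    · simp [hv]
    · simp [maskVec, h v hv]
  · push Not at h
    obtain ⟨v, hv, hwv⟩ := h
    exact Finset.prod_eq_zero (Finset.mem_univ v) (by simp [maskVec, hwv, zero_pow hv])

/-- **The weight count.**  If the components of `G` below `ν` vanish and all weights are `≥ 1`, the
degree-`ν` component of `G` evaluated at the masked vector `Λ` is the coefficient of `s^ν` in `ψ(G)`. -/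
theorem eval_maskVec_homogeneousComponent (hw : ∀ v, 1 ≤ w v) {G : FPoly n} {ν : ℕ}
    (hlow : ∀ j < ν, homogeneousComponent j G = 0) :
    eval (maskVec lam w) (homogeneousComponent ν G) = (maskHom lam w G).coeff ν := by
  classical
  -- every monomial of `G` has degree `≥ ν`
  have hdeg : ∀ d ∈ G.support, ν ≤ d.degree := fun d hd => by
    by_contra hlt
    push Not at hlt
    have h := congr_arg (coeff d) (hlow _ hlt)
    rw [coeff_homogeneousComponent, if_pos rfl, coeff_zero] at h
    exact (mem_support_iff.1 hd) h
  rw [coeff_maskHom, homogeneousComponent_apply, map_sum, Finset.sum_filter]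
  refine Finset.sum_congr rfl fun d hd => ?_
  rw [eval_monomial, Finsupp.prod_fintype _ _ (fun v => by simp), prod_maskVec_pow]
  by_cases hdν : d.degree = ν
  · rw [if_pos hdν]
    by_cases hall : ∀ v, d v ≠ 0 → w v = 1
    · rw [if_pos hall, if_pos (((wdeg_eq_degree_iff hw d).2 hall).trans hdν)]
    · rw [if_neg hall, mul_zero, if_neg]
      intro h
      exact hall ((wdeg_eq_degree_iff hw d).1 (h.trans hdν.symm))
  · rw [if_neg hdν, if_neg]
    intro h
    have h1 := degree_le_wdeg hw d
    have h2 := hdeg d hd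
    omega

/-- Below the order, the coefficients of `ψ(G)` vanish. -/
theorem coeff_maskHom_eq_zero_of_lt (hw : ∀ v, 1 ≤ w v) {G : FPoly n} {ν : ℕ}
    (hlow : ∀ j < ν, homogeneousComponent j G = 0) {j : ℕ} (hj : j < ν) :
    (maskHom lam w G).coeff j = 0 := by
  have hlow' : ∀ i < j, homogeneousComponent i G = 0 := fun i hi => hlow i (hi.trans hj)
  rw [← eval_maskVec_homogeneousComponent hw hlow', hlow j hj, map_zero]

/-- `liftF f_q = F_q`. -/
theorem liftF_generator (q : Fin n × Fin n) : liftF n (generator n q) = X q := by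
  rw [← substF_X q, liftF_substF]

/-- **MASKING CERTIFICATE.**  If `s^N` divides `ψ(liftF t)` for every test `t` of `E`, all weights are
`≥ 1`, and the masked vector does not vanish at `y` (`λ_v(y) ≠ 0` for some weight-one `v`), then the
test IDEAL of `E` is not initially isolated to any order `K < N` over `y`. -/
theorem not_idealInitIsolatedAt_of_maskCert {E : EqSystem n} {K N : ℕ} (hKN : K < N)
    (hw : ∀ v, 1 ≤ w v)
    (hdiv : ∀ o : Fin E.tests.length,
      Polynomial.X ^ N ∣ maskHom lam w (liftF n (E.testPoly (E.tests.get o))))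
    {y : MatMulVars n → ℂ} (hy : ∃ v, w v = 1 ∧ eval y (lam v) ≠ 0) :
    ¬ E.IdealInitIsolatedAt K y := by
  classical
  rintro ⟨T, u, hu, ν, G, hν, hG, hlow, hiso⟩
  -- the ring map `u ↦ ψ(liftF u)` sends the test ideal into `(s^N)`
  set Φ : MvPolynomial (GraphVars n) ℂ →+* Polynomial (MvPolynomial (MatMulVars n) ℂ) :=
    (maskHom lam w).toRingHom.comp (liftF n : MvPolynomial (GraphVars n) ℂ →+* FPoly n) with hΦ
  have hspan : Ideal.span (Set.range fun o : Fin E.tests.length => E.testPoly (E.tests.get o)) ≤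
      Ideal.comap Φ (Ideal.span {Polynomial.X ^ N}) := by
    rw [Ideal.span_le]
    rintro _ ⟨o, rfl⟩
    exact Ideal.mem_comap.2 (Ideal.mem_span_singleton.2 (hdiv o))
  have hGu : ∀ i, G i = liftF n (u i) := fun i => by rw [← hG i, liftF_substF]
  have hdivG : ∀ i, Polynomial.X ^ N ∣ maskHom lam w (G i) := fun i => by
    have h := Ideal.mem_comap.1 (hspan (hu i))
    rw [Ideal.mem_span_singleton] at h
    rw [hGu i]; exact h
  -- every admissible initial form vanishes at `Λ`
  have hcoef : ∀ i, 1 ≤ ν i → eval (maskVec lam w) (homogeneousComponent (ν i) (G i)) = 0 := by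
    intro i hi
    rw [eval_maskVec_homogeneousComponent hw (hlow i)]
    obtain ⟨p, hp⟩ := hdivG i
    rw [hp, Polynomial.coeff_X_pow_mul', if_neg]
    have := hν i; omega
  -- test the isolation at `F₀ = Λ(y)`
  set F₀ : Fin n × Fin n → ℂ := fun v => eval y (maskVec lam w v) with hF₀
  have hF : ∀ i, eval F₀ (map (eval y) (homogeneousComponent (ν i) (G i))) =
      eval 0 (map (eval y) (homogeneousComponent (ν i) (G i))) := by
    intro i
    rcases Nat.eq_zero_or_pos (ν i) with h0 | hpos
    · rw [h0]
      have hh : (map (eval y) (homogeneousComponent 0 (G i))).IsHomogeneous 0 :=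
        (homogeneousComponent_isHomogeneous 0 (G i)).map _
      rw [eq_C_of_isHomogeneous_zero hh, eval_C, eval_C]
    · have hh : (map (eval y) (homogeneousComponent (ν i) (G i))).IsHomogeneous (ν i) :=
        (homogeneousComponent_isHomogeneous _ _).map _
      rw [eval_zero_of_isHomogeneous hh hpos.ne', MvPolynomial.eval_map]
      have h := congr_arg (eval y) (hcoef i hpos)
      change eval y (eval₂ (RingHom.id _) (maskVec lam w) (homogeneousComponent (ν i) (G i))) =
        eval y 0 at h
      rw [eval₂_comp_left, RingHom.comp_id, map_zero] at h
      exact h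
  obtain ⟨v, hv1, hv⟩ := hy
  have h0 := congr_fun (hiso F₀ hF) v
  simp [hF₀, maskVec, hv1] at h0
  exact hv h0

end MaskCert

/-! ## Chain systems -/

section Chain

variable (n)

/-- The `i`-th position of the chain: the enumeration of `Fin n × Fin n` by `Fin (n·n)`. -/
def chainPos (i : Fin (n * n)) : Fin n × Fin n := finProdFinEquiv.symm i

/-- The chain tests: `t_i = f_{p_i} − f_{p_{i+1}}²` for `i + 1 < n²`, and `t_{n²−1} = f_{p₀}²`. -/
def chainTest (i : Fin (n * n)) : MvPolynomial (GraphVars n) ℂ :=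
  if h : i.val + 1 < n * n then
    generator n (chainPos n i) - generator n (chainPos n ⟨i.val + 1, h⟩) ^ 2
  else generator n (chainPos n ⟨0, i.pos⟩) ^ 2

/-- The chain weights `w_{p_i} = 2^{n² − 1 − i}`. -/
def chainWeight (v : Fin n × Fin n) : ℕ := 2 ^ (n * n - 1 - (finProdFinEquiv v).val)

variable {n}

/-- The weight of the `i`-th chain position. -/
theorem chainWeight_chainPos (i : Fin (n * n)) :
    chainWeight n (chainPos n i) = 2 ^ (n * n - 1 - i.val) := by
  simp only [chainWeight, chainPos, Equiv.apply_symm_apply]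

/-- Chain weights are `≥ 1`. -/
theorem one_le_chainWeight (v : Fin n × Fin n) : 1 ≤ chainWeight n v := Nat.one_le_two_pow

/-- Every chain test has degree `≤ 4`. -/
theorem totalDegree_chainTest_le (i : Fin (n * n)) : (chainTest n i).totalDegree ≤ 4 := by
  have h2 : ∀ q, (generator n q ^ 2).totalDegree ≤ 4 := fun q =>
    (totalDegree_pow _ _).trans (by have := totalDegree_generator_le_two n q; omega)
  unfold chainTest
  split_ifs with h
  · exact (totalDegree_sub _ _).trans
      (max_le ((totalDegree_generator_le_two n _).trans (by norm_num)) (h2 _))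
  · exact h2 _

/-- `x ∈ W_n` iff every generator vanishes at `x`. -/
theorem mem_mmGraph_iff_eval_generator (x : GraphVars n → ℂ) :
    x ∈ mmGraph n ↔ ∀ q, eval x (generator n q) = 0 := by
  simp only [mmGraph, Set.mem_setOf_eq, generator, map_sub, map_sum, map_mul, eval_X, sub_eq_zero]
  exact ⟨fun h q => h q.1 q.2, fun h i l => h (i, l)⟩

/-- **Correctness of the chain**: the chain tests vanish at `x` iff `x ∈ W_n`
(`f_{p₀}² = 0` and `f_{p_i} = f_{p_{i+1}}²` force every `f_{p_i} = 0`, by induction along the chain). -/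
theorem chainTest_zero_iff (x : GraphVars n → ℂ) :
    (∀ i, eval x (chainTest n i) = 0) ↔ x ∈ mmGraph n := by
  rw [mem_mmGraph_iff_eval_generator]
  refine ⟨fun h => ?_, fun h i => ?_⟩
  · have step : ∀ (i : Fin (n * n)) (hi : i.val + 1 < n * n),
        eval x (generator n (chainPos n i)) =
          eval x (generator n (chainPos n ⟨i.val + 1, hi⟩)) ^ 2 := by
      intro i hi
      have := h i
      rw [chainTest, dif_pos hi, map_sub, map_pow, sub_eq_zero] at this
      exact this
    have all : ∀ k : ℕ, ∀ hk : k < n * n, eval x (generator n (chainPos n ⟨k, hk⟩)) = 0 := by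
      intro k
      induction k with
      | zero =>
        intro hk
        have hlast := h ⟨n * n - 1, by omega⟩
        rw [chainTest, dif_neg (by simp; omega), map_pow] at hlast
        exact pow_eq_zero_iff (two_ne_zero) |>.1 hlast
      | succ k ih =>
        intro hk
        have h1 := step ⟨k, by omega⟩ hk
        rw [ih (by omega)] at h1
        exact pow_eq_zero_iff (two_ne_zero) |>.1 h1.symm
    intro q
    have := all (finProdFinEquiv q).val (finProdFinEquiv q).isLt
    rwa [Fin.eta, chainPos, Equiv.symm_apply_apply] at this
  · unfold chainTest
    split_ifs <;> simp [h]

/-- The lifted chain tests: `liftF t_i = F_{p_i} − F_{p_{i+1}}²`, resp. `F_{p₀}²`. -/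
theorem liftF_chainTest (i : Fin (n * n)) :
    liftF n (chainTest n i) =
      if h : i.val + 1 < n * n then X (chainPos n i) - X (chainPos n ⟨i.val + 1, h⟩) ^ 2
      else X (chainPos n ⟨0, i.pos⟩) ^ 2 := by
  unfold chainTest
  split_ifs <;> simp [map_sub, map_pow, liftF_generator]

/-- **The chain is masked to order `2^{n²} − 1` along `e_{p_{n²−1}}`**: under
`ψ : F_{p_i} ↦ s^{2^{n²−1−i}}` every lifted chain test is divisible by `s^{2^{n²}}`
(`F_{p_i} − F_{p_{i+1}}² ↦ 0`, `F_{p₀}² ↦ s^{2^{n²}}`). -/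
theorem X_pow_dvd_maskHom_chainTest (i : Fin (n * n)) :
    Polynomial.X ^ (2 ^ (n * n)) ∣ maskHom (fun _ => 1) (chainWeight n) (liftF n (chainTest n i)) := by
  rw [liftF_chainTest]
  split_ifs with h
  · refine ⟨0, ?_⟩
    rw [mul_zero, map_sub, map_pow, maskHom, aeval_X, aeval_X, chainWeight_chainPos,
      chainWeight_chainPos, map_one, one_mul, one_mul, ← pow_mul, sub_eq_zero]
    congr 1
    have : n * n - 1 - i.val = (n * n - 1 - (i.val + 1)) + 1 := by omega
    rw [this, pow_succ]
  · refine ⟨1, ?_⟩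
    rw [mul_one, map_pow, maskHom, aeval_X, chainWeight_chainPos, map_one, one_mul, ← pow_mul]
    congr 1
    have : n * n - 1 - 0 + 1 = n * n := by have := i.pos; omega
    rw [← pow_succ, this]

/-- **CHAIN SYSTEMS EXIST**: for every `n ≥ 1` a correct system with tests of degree `≤ 4` whose test
ideal is initially isolated to NO order `K < 2^{n²}` over ANY base pair. -/
theorem exists_chainSystem (hn : 1 ≤ n) :
    ∃ E : EqSystem n, E.Correct ∧ E.IsDegLe 4 ∧
      ∀ K, K < 2 ^ (n * n) → ∀ y, ¬ E.IdealInitIsolatedAt K y := by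
  classical
  obtain ⟨gs, idx, hfan, -, hval⟩ := exists_gates_exposing ((List.finRange (n * n)).map (chainTest n))
  let E : EqSystem n := ⟨⟨gs, .const 0⟩, idx⟩
  have hto : ∀ j ∈ E.tests, ∃ i, E.testPoly j = chainTest n i := fun j hj => by
    have hm : (gateValues gs).getD j 0 ∈ (List.finRange (n * n)).map (chainTest n) := by
      rw [← hval]; exact List.mem_map_of_mem hj
    obtain ⟨i, -, hi⟩ := List.mem_map.1 hm
    exact ⟨i, hi.symm⟩
  have hfrom : ∀ i, ∃ j ∈ E.tests, E.testPoly j = chainTest n i := fun i => by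
    have hm : chainTest n i ∈ idx.map fun j => (gateValues gs).getD j 0 := by
      rw [hval]; exact List.mem_map_of_mem (List.mem_finRange i)
    obtain ⟨j, hj, hji⟩ := List.mem_map.1 hm
    exact ⟨j, hj, hji⟩
  refine ⟨E, ⟨hfan, Set.ext fun x => ⟨fun hx => ?_, fun hx j hj => ?_⟩⟩, fun o => ?_, fun K hK y => ?_⟩
  · refine (chainTest_zero_iff x).1 fun i => ?_
    obtain ⟨j, hj, hji⟩ := hfrom i
    rw [← hji]; exact hx j hj
  · obtain ⟨i, hi⟩ := hto j hj
    rw [hi]; exact (chainTest_zero_iff x).2 hx i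
  · obtain ⟨i, hi⟩ := hto (E.tests.get o) (List.get_mem _ _)
    rw [hi]; exact totalDegree_chainTest_le i
  · refine not_idealInitIsolatedAt_of_maskCert (lam := fun _ => 1) (w := chainWeight n) hK
      one_le_chainWeight (fun o => ?_) ⟨chainPos n ⟨n * n - 1, by have := Nat.mul_le_mul hn hn; omega⟩, ?_, by simp⟩
    · obtain ⟨i, hi⟩ := hto (E.tests.get o) (List.get_mem _ _)
      rw [hi]; exact X_pow_dvd_maskHom_chainTest i
    · rw [chainWeight_chainPos]; simp

end Chain

/-! ## The order dial is dead from degree four on -/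

/-- **`DegreeBoundsIsoOrder 4 K` fails for every `K`** (chains with `n = K + 1`, so `K < 2^{n²}`). -/
theorem not_degreeBoundsIsoOrder_four (K : ℕ) : ¬ DegreeBoundsIsoOrder 4 K := by
  intro h
  obtain ⟨E, hE, hdeg, hmask⟩ := exists_chainSystem (n := K + 1) (by omega)
  obtain ⟨y, hy⟩ := h (K + 1) (by omega) E hE hdeg
  have hK : K < 2 ^ ((K + 1) * (K + 1)) :=
    lt_of_lt_of_le (Nat.lt_two_pow_self) (Nat.pow_le_pow_right (by norm_num) (by nlinarith))
  exact hmask K hK y hy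

/-- **No rung `D ≥ 4` of the degree ladder is reachable through the isolation order**:
`¬ DegreeBoundsIsoOrder D K` for all `D ≥ 4` and all `K`.  (M70's bridge
`DegreeBoundsIsoOrder D 2 → EquationsForceMultiplicationDeg D` is vacuous for `D ≥ 4`.) -/
theorem not_degreeBoundsIsoOrder_of_four_le {D : ℕ} (hD : 4 ≤ D) (K : ℕ) :
    ¬ DegreeBoundsIsoOrder D K :=
  fun h => not_degreeBoundsIsoOrder_four K (h.anti_deg hD)

/-- The degree-`4` rung in the currency M70 proposed (`K = 2`), refuted outright: for every `n ≥ 2`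
a correct degree-`4` system masked to order `2` over every base pair. -/
theorem exists_correct_degFour_not_idealIso_two (hn : 2 ≤ n) :
    ∃ E : EqSystem n, E.Correct ∧ E.IsDegLe 4 ∧ ∀ y, ¬ E.IdealInitIsolatedAt 2 y := by
  obtain ⟨E, hE, hdeg, hmask⟩ := exists_chainSystem (n := n) (by omega)
  refine ⟨E, hE, hdeg, fun y => hmask 2 ?_ y⟩
  calc 2 < 2 ^ (2 * 2) := by norm_num
    _ ≤ 2 ^ (n * n) := Nat.pow_le_pow_right (by norm_num) (Nat.mul_le_mul hn hn)

/-- Summary, in the vocabulary of the degree ladder (M67/M70): the order dial decides the cubic rung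
and nothing above it — `EquationsForceMultiplicationDeg D` holds for `D ≤ 3` (M67) while its only
typed sufficient condition `DegreeBoundsIsoOrder D 2` fails for every `D ≥ 4`. -/
theorem degreeLadder_orderDial_summary :
    (∀ D, D ≤ 3 → EquationsForceMultiplicationDeg D) ∧ (∀ D, 4 ≤ D → ∀ K, ¬ DegreeBoundsIsoOrder D K) :=
  ⟨fun _ hD => equationsForceMultiplicationDeg_of_le_three hD, fun _ hD K =>
    not_degreeBoundsIsoOrder_of_four_le hD K⟩

end Summit.MatrixMultiplication.MatrixMultiplication.Theorems.GraphEquations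

end
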